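import Summits.ABC.ABC.Theses.RibetTakahashiSplit
import Literature.NumberTheory.EllipticCurves.DegreeConjectureAbcSemistable
import Literature.NumberTheory.EllipticCurves.NewformPeterssonSize
import Literature.NumberTheory.Automorphic.BrandtXi

/-!
# Sketch (ideator 5, round 2) for crux stmt-ABC-17927 `RibetTakahashiSplit.ThinWeightedSzpiro` (r3″)

Idea card `degree-side-prime-spectrum`.  Only DEFINITIONS that must elaborate (no proofs, no sorry):

* `ThinDegreeBound`  — C⁺, the degree-side form of r3″ (modular degree of the conductor-level
  parametrisation of a θ-thin global minimal model ≤ C·c²·N^{1+ε}·(N·T)^{1+ε});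
* `Transfer`         — FIRST LEMMA of the line: Petersson lower bound (named fact, route item
  stmt-ABC-10870) → ThinDegreeBound → r3″ (Zagier `covolume_ge_of_deg_le` + Silverman
  `silverman1986_discriminant_c4_covolume_holds`, both in the tree);
* `ThinXiBound`      — the route-native target in which T is CONSUMED by the Ribet–Takahashi /
  Takahashi identity (`modularDegree_le_brandtXi_mul`): definite ξ(N/q, q) ≤ C N^{2+ε} T^{ε};
* `SquarefreeDegreeKernel`, `KernelTransfer` — the squarefree-Δ kernel (p153315) in degree form;
* `CongruencePrimeCeiling A` — the strictly sub-kernel target: no prime factor of the minimal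
  modular degree of a squarefree-Δ curve exceeds C·N^A.
-/

open WeierstrassCurve IsDedekindDomain
open Literature.NumberTheory.EllipticCurves.ModularForms

set_option linter.dupNamespace false

noncomputable section

namespace Summit.ABC.ABC.Cruxes.ThinWeightedSzpiro.Ideator5

/-- Conductor of the ℚ-curve of an integral model. -/
def condN (W₀ : WeierstrassCurve ℤ) : ℕ := (W₀.baseChange ℚ).conductorNorm ℤ

/-- The weight `T(W₀) = ∏_{p ∥ N} ord_p Δ_min` of the crux. -/
def weightT (W₀ : WeierstrassCurve ℤ) : ℕ :=
  ∏ p ∈ (condN W₀).primeFactors with ¬ p ^ 2 ∣ condN W₀,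
    ((W₀.baseChange ℚ).minimalDiscriminantNorm ℤ).factorization p

/-- Class membership of the crux: elliptic, minimal at every prime, semistable away from 2. -/
def InClass (W₀ : WeierstrassCurve ℤ) : Prop :=
  (W₀.baseChange ℚ).IsElliptic ∧ (∀ v : HeightOneSpectrum ℤ, (W₀.baseChange ℚ).IsMinimalAt v) ∧
    (∀ p : ℕ, p.Prime → p ≠ 2 → ¬ p ^ 2 ∣ condN W₀)

/-- θ-thinness at level `K`. -/
def ThinAt (θ K : ℝ) (W₀ : WeierstrassCurve ℤ) : Prop :=
  (weightT W₀ : ℝ) ≤ K * (condN W₀ : ℝ) ^ θ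

/-- **C⁺ (degree side of r3″).**  On the θ-thin class the conductor-level modular parametrisation
has degree `≤ C · c² · N^{1+ε} · (N·T)^{1+ε}` (`c` = Manin constant of the datum). -/
def ThinDegreeBound : Prop :=
  ∃ θ : ℝ, 0 < θ ∧ ∀ ε : ℝ, 0 < ε → ∀ K : ℝ, ∃ C : ℝ, ∀ W₀ : WeierstrassCurve ℤ,
    InClass W₀ → ThinAt θ K W₀ → ∀ (N : ℕ) [NeZero N], condN W₀ = N →
      ∃ D : ModularParametrizationData (W₀.baseChange ℚ) N,
        (D.deg : ℝ) ≤ C * (D.c : ℝ) ^ 2 * (N : ℝ) ^ (1 + ε) * ((N : ℝ) * (weightT W₀ : ℝ)) ^ (1 + ε)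

/-- **First lemma (stub_transfer of the line).**  Petersson lower bound → C⁺ → r3″. -/
def Transfer : Prop :=
  murty_petersson_newform_lower_bound → ThinDegreeBound →
    Summit.ABC.ABC.Theses.RibetTakahashiSplit.ThinWeightedSzpiro

/-- **Route-native target: the definite ξ on the thin class.**  For every odd multiplicative prime
`q` of a θ-thin model, `ξ(N/q, q) ≤ C · N^{2+ε} · T^{ε}`; with Takahashi's identity
`deg_min ≤ C_ε N^ε · ξ(N/q,q) · ord_q Δ_min` (tree: `modularDegree_le_brandtXi_mul`, Frey/optimal
versions) and `ord_q Δ_min ≤ T` this gives `ThinDegreeBound` — the one place T is consumed. -/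
def ThinXiBound : Prop :=
  ∃ θ : ℝ, 0 < θ ∧ ∀ ε : ℝ, 0 < ε → ∀ K : ℝ, ∃ C : ℝ, ∀ W₀ : WeierstrassCurve ℤ,
    InClass W₀ → ThinAt θ K W₀ → ∀ q : ℕ, q.Prime → q ≠ 2 → q ∣ condN W₀ →
      (Literature.NumberTheory.Automorphic.brandtXi (condN W₀ / q) q
          (fun n => (W₀.baseChange ℚ).LFunction n) : ℝ)
        ≤ C * (condN W₀ : ℝ) ^ (2 + ε) * (weightT W₀ : ℝ) ^ ε

/-- **The squarefree-Δ kernel in degree form** (degree conjecture for I₁-everywhere curves). -/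
def SquarefreeDegreeKernel : Prop :=
  ∀ ε : ℝ, 0 < ε → ∃ C : ℝ, ∀ W₀ : WeierstrassCurve ℤ, Squarefree W₀.Δ.natAbs →
    ∀ (N : ℕ) [NeZero N], condN W₀ = N →
      ∃ D : ModularParametrizationData (W₀.baseChange ℚ) N,
        (D.deg : ℝ) ≤ C * (D.c : ℝ) ^ 2 * (N : ℝ) ^ (2 + ε)

/-- Kernel transfer: the degree-form kernel gives p153315's Hall kernel (same Zagier+Silverman). -/
def KernelTransfer : Prop :=
  murty_petersson_newform_lower_bound → SquarefreeDegreeKernel →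
    ∀ ε : ℝ, 0 < ε → ∃ C : ℝ, ∀ W₀ : WeierstrassCurve ℤ, Squarefree W₀.Δ.natAbs →
      ((|W₀.c₄| ^ 3 : ℤ) : ℝ) ≤ C * ((W₀.Δ.natAbs : ℕ) : ℝ) ^ (6 + ε)

/-- **Strictly sub-kernel target: congruence-prime CEILING.**  No prime factor of the minimal
modular degree of a squarefree-Δ curve exceeds `C · N^A`. -/
def CongruencePrimeCeiling (A : ℝ) : Prop :=
  ∃ C : ℝ, ∀ W₀ : WeierstrassCurve ℤ, Squarefree W₀.Δ.natAbs →
    ∀ (N : ℕ) [NeZero N], condN W₀ = N →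
      ∀ D : ModularParametrizationData (W₀.baseChange ℚ) N,
        (∀ D' : ModularParametrizationData (W₀.baseChange ℚ) N, D.deg ≤ D'.deg) →
          ∀ p : ℕ, p.Prime → p ∣ D.deg → (p : ℝ) ≤ C * (N : ℝ) ^ A

/-- The kernel implies the ceiling at `A = 2 + ε` modulo a uniform Manin-constant bound
(stated, not proved: the depth/ceiling split of the card). -/
def KernelGivesCeiling : Prop :=
  SquarefreeDegreeKernel → (∃ B : ℕ, ∀ (W₀ : WeierstrassCurve ℤ) (N : ℕ) [NeZero N]
    (D : ModularParametrizationData (W₀.baseChange ℚ) N), D.c.natAbs ≤ B) →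
      ∀ ε : ℝ, 0 < ε → CongruencePrimeCeiling (2 + ε)

end Summit.ABC.ABC.Cruxes.ThinWeightedSzpiro.Ideator5

end
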